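import Summits.AnomalousDissipation.AnomalousDissipation.Theorems.WazewskiBlockSubLaminarObliqueLaminar
import Literature.Analysis.FluidPDE.SteadyGalerkinApprox

/-!
# Route `WazewskiBlock`, item stmt-AnomalousDissipation-10354 — the oblique class, III: energy,
# coercivity, and the steady states attached to zeros of `obliqueField`

* `sum_mul_obliqueField` — the energy identity in oblique coordinates,
  `∑_p x_p G(x)_p = ½ (ν‖∇u‖² - ∫⟪f,u⟫)` (master identity II of the Galerkin field);
* `sum_mul_obliqueField_pos` — coercivity on `{‖x‖₂ > |F|/(16νπ²)}` (`‖∇u‖² ≥ 16π²‖x‖²` on the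
  lattice, work `≤ |F|‖x‖`), the hypothesis of the index theorem
  `Literature.Topology.Euclidean.exists_zero_ne_of_det_fderiv_neg`;
* `steady_of_obliqueField_eq_zero` — a zero of `obliqueField` gives a Galerkin mode of order `N`,
  mean zero, solving the tested steady Galerkin equations with the Kolmogorov force
  `F sin(4πx₁)e₀ = (F · Im e^{2πi e·x}) • e₀` and the steady energy equation — exactly the per-`N`
  hypotheses of `subLaminarThreeDTrap_of_steadyStates` (file
  `WazewskiBlockSubLaminarThreeDTrapAtOneViscosity`).

All statements proved; no definitions.
-/

noncomputable section

-- `Summit.<Summit>.<Problem>` is the tree's mandated summit-side namespace (CONVENTIONS §2); deliberate duplicate.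
set_option linter.dupNamespace false

open scoped InnerProductSpace ComplexConjugate
open Finset
open Literature.Analysis.FunctionSpaces Literature.Analysis.FunctionSpaces.Torus
open Literature.Analysis.FluidPDE Literature.Analysis.FluidPDE.Torus

namespace Summit.AnomalousDissipation.AnomalousDissipation.Theorems.Oblique
/-! ### The energy pairing in oblique coordinates (coercivity) -/

/-- The lattice modes are the representatives and their negatives. [folklore] -/
theorem obliqueModes_eq_union (N : ℕ) :
    obliqueModes N = obliqueReps N ∪ (obliqueReps N).image Neg.neg := by
  ext k
  rw [Finset.mem_union, Finset.mem_image]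
  constructor
  · intro hk
    rcases mem_obliqueReps_or_neg_mem hk with h | h
    · exact Or.inl h
    · exact Or.inr ⟨-k, h, neg_neg k⟩
  · rintro (h | ⟨l, hl, rfl⟩)
    · exact obliqueReps_subset N h
    · exact neg_mem_obliqueModes (obliqueReps_subset N hl)

/-- Representatives and their negatives are disjoint. [folklore] -/
theorem disjoint_obliqueReps_image_neg (N : ℕ) :
    Disjoint (obliqueReps N) ((obliqueReps N).image Neg.neg) := by
  rw [Finset.disjoint_left]
  rintro k hk hk'
  obtain ⟨l, hl, rfl⟩ := Finset.mem_image.1 hk'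
  exact not_neg_mem_obliqueReps hl hk

/-- Sums over the lattice modes fold onto the representatives. [folklore] -/
theorem sum_obliqueModes_eq {M : Type*} [AddCommMonoid M] (N : ℕ) (f : (Fin 3 → ℤ) → M) :
    ∑ k ∈ obliqueModes N, f k = ∑ k ∈ obliqueReps N, (f k + f (-k)) := by
  rw [obliqueModes_eq_union, Finset.sum_union (disjoint_obliqueReps_image_neg N),
    Finset.sum_image fun a _ b _ (h : -a = -b) => neg_injective h, ← Finset.sum_add_distrib]

/-- Inner products of conjugated vectors. [folklore] -/
theorem inner_conjVec_conjVec (a b : EuclideanSpace ℂ (Fin 3)) :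
    ⟪EuclideanSpace.conjVec a, EuclideanSpace.conjVec b⟫_ℂ = conj ⟪a, b⟫_ℂ := by
  simp only [PiLp.inner_apply, EuclideanSpace.conjVec_apply, map_sum]
  refine Finset.sum_congr rfl fun j _ => ?_
  simp [mul_comm]

/-- **The pairing on a representative**: `Re ⟪Φ x k, w⟫ = ∑_σ x (k,σ) · (basisVec k σ · Im w)`.
[folklore] -/
theorem re_inner_obliqueCoeff_rep {N : ℕ} (x : ObliqueIndex N → ℝ) (k : ↥(obliqueReps N))
    (w : EuclideanSpace ℂ (Fin 3)) :
    (⟪obliqueCoeff N x ⟨(k : Fin 3 → ℤ), mem_freqBall_of_mem_obliqueReps k.2⟩, w⟫_ℂ).re =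
      ∑ σ : Fin 2, x (k, σ) * ∑ j : Fin 3, basisVec (k : Fin 3 → ℤ) σ j * (w j).im := by
  rw [obliqueCoeff_apply_of_mem x (k := ⟨(k : Fin 3 → ℤ), mem_freqBall_of_mem_obliqueReps k.2⟩) k.2]
  simp only [PiLp.inner_apply, RCLike.inner_apply, PiLp.smul_apply, EuclideanSpace.complexify_apply,
    smul_eq_mul, map_mul, Complex.conj_I, Complex.conj_ofReal, Complex.re_sum]
  simp only [WithLp.ofLp_sum, WithLp.ofLp_smul, Finset.sum_apply, Pi.smul_apply, smul_eq_mul,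
    Complex.ofReal_sum, Complex.ofReal_mul, Finset.mul_sum, Complex.re_sum]
  rw [Finset.sum_comm]
  refine Finset.sum_congr rfl fun σ _ => Finset.sum_congr rfl fun j _ => ?_
  simp only [Complex.mul_re, Complex.mul_im, Complex.neg_re, Complex.neg_im, Complex.I_re, Complex.I_im,
    Complex.ofReal_re, Complex.ofReal_im, Subtype.coe_eta]
  ring

/-- **The `ℓ²(S)` pairing of `Φ x` with a real coefficient vector, in oblique coordinates**:
`∑_{k ∈ S} Re ⟪(Φ x)‾ k, v̄ k⟫ = 2 ∑_p x_p (Ψ v)_p` (the terms off the lattice vanish and the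
terms at `-k` repeat those at `k`). [folklore] -/
theorem sum_re_inner_obliqueCoeff {N : ℕ} (x : ObliqueIndex N → ℝ)
    {v : ↥(freqBall (d := Fin 3) N) → EuclideanSpace ℂ (Fin 3)} (hv : IsRealCoeff v) :
    ∑ k ∈ freqBall (d := Fin 3) N,
        (⟪coeffExt (freqBall (d := Fin 3) N) (obliqueCoeff N x) k, coeffExt (freqBall (d := Fin 3) N) v k⟫_ℂ).re =
      2 * ∑ p : ObliqueIndex N, x p * obliqueCoord N v p := by
  set f : (Fin 3 → ℤ) → ℝ := fun k => (⟪coeffExt (freqBall (d := Fin 3) N) (obliqueCoeff N x) k, coeffExt (freqBall (d := Fin 3) N) v k⟫_ℂ).re with hf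
  have hcs : IsConjSymm (coeffExt (freqBall (d := Fin 3) N) (obliqueCoeff N x)) := (isRealCoeff_obliqueCoeff x).isConjSymm_coeffExt (freqBall_symm N)
  have hvs : IsConjSymm (coeffExt (freqBall (d := Fin 3) N) v) := hv.isConjSymm_coeffExt (freqBall_symm N)
  -- restrict to the lattice
  have h1 : ∑ k ∈ (freqBall (d := Fin 3) N), f k = ∑ k ∈ obliqueModes N, f k := by
    refine (Finset.sum_subset (obliqueModes_subset N) fun k hkS hk => ?_).symm
    simp only [hf]
    rw [coeffExt_of_mem _ hkS, obliqueCoeff_apply_of_not_mem x (k := ⟨k, hkS⟩) hk, inner_zero_left,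
      Complex.zero_re]
  -- fold onto representatives
  have h2 : ∀ k ∈ obliqueReps N, f (-k) = f k := fun k _ => by
    simp only [hf, hcs k, hvs k, inner_conjVec_conjVec, Complex.conj_re]
  rw [h1, sum_obliqueModes_eq, Finset.sum_congr rfl fun k hk => by rw [h2 k hk, ← two_mul], ← Finset.mul_sum,
    Fintype.sum_prod_type, ← Finset.sum_coe_sort (obliqueReps N)]
  congr 1
  refine Finset.sum_congr rfl fun k _ => ?_
  have hkS : (k : Fin 3 → ℤ) ∈ (freqBall (d := Fin 3) N) := mem_freqBall_of_mem_obliqueReps k.2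
  simp only [hf, coeffExt_of_mem _ hkS]
  rw [re_inner_obliqueCoeff_rep x k]
  rfl

/-- **The energy identity in oblique coordinates**: with `u = realTrigPoly (freqBall (d := Fin 3) N) (Φ x)‾` and
`f = realTrigPoly (freqBall (d := Fin 3) N) f̂‾`, `∑_p x_p · obliqueField x p = ½ (ν ‖∇u‖² - ∫ ⟪f, u⟫)`
(master identity II of the Galerkin field; the convection term drops out). [folklore] -/
theorem sum_mul_obliqueField {N : ℕ} (ν F : ℝ) (x : ObliqueIndex N → ℝ) :
    ∑ p : ObliqueIndex N, x p * obliqueField ν F N x p =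
      2⁻¹ * (ν * (eGradNormSq (realTrigPoly (freqBall (d := Fin 3) N)
          (coeffExt (freqBall (d := Fin 3) N) (obliqueCoeff N x)))).toReal -
        ∫ y, ⟪realTrigPoly (freqBall (d := Fin 3) N) (coeffExt (freqBall (d := Fin 3) N) (kolmogorovCoeff F N)) y,
          realTrigPoly (freqBall (d := Fin 3) N) (coeffExt (freqBall (d := Fin 3) N) (obliqueCoeff N x)) y⟫_ℝ) := by
  have hS := freqBall_symm N
  have hcs : IsConjSymm (coeffExt (freqBall (d := Fin 3) N) (obliqueCoeff N x)) := (isRealCoeff_obliqueCoeff x).isConjSymm_coeffExt hS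
  have hgs : IsConjSymm (coeffExt (freqBall (d := Fin 3) N) (kolmogorovCoeff F N)) := (isRealCoeff_kolmogorovCoeff F N).isConjSymm_coeffExt hS
  have hcT : IsTransversal (freqBall (d := Fin 3) N) (coeffExt (freqBall (d := Fin 3) N) (obliqueCoeff N x)) := (isSolenoidalCoeff_obliqueCoeff x).isTransversal_coeffExt
  have hmaster := sum_re_inner_galerkinField_self ν hS hgs hcs hcT
  have hv : IsRealCoeff (galerkinRHS (freqBall (d := Fin 3) N) ν (kolmogorovCoeff F N) (obliqueCoeff N x)) :=
    (galerkinRHS_mem ν hS (isRealCoeff_kolmogorovCoeff F N) (obliqueCoeff_mem x)).1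
  have hpair := sum_re_inner_obliqueCoeff x hv
  have hsame : ∑ k ∈ (freqBall (d := Fin 3) N), (⟪coeffExt (freqBall (d := Fin 3) N) (obliqueCoeff N x) k,
      coeffExt (freqBall (d := Fin 3) N) (galerkinRHS (freqBall (d := Fin 3) N) ν (kolmogorovCoeff F N) (obliqueCoeff N x)) k⟫_ℂ).re =
      ∑ k ∈ (freqBall (d := Fin 3) N), (⟪coeffExt (freqBall (d := Fin 3) N) (obliqueCoeff N x) k,
        galerkinField ν (freqBall (d := Fin 3) N) (coeffExt (freqBall (d := Fin 3) N) (kolmogorovCoeff F N)) (coeffExt (freqBall (d := Fin 3) N) (obliqueCoeff N x)) k⟫_ℂ).re :=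
    Finset.sum_congr rfl fun k hk => by simp only [coeffExt_of_mem _ hk, galerkinRHS_apply]
  have : ∑ p : ObliqueIndex N, x p * obliqueField ν F N x p =
      -∑ p : ObliqueIndex N, x p * obliqueCoord N (galerkinRHS (freqBall (d := Fin 3) N) ν (kolmogorovCoeff F N) (obliqueCoeff N x)) p := by
    rw [← Finset.sum_neg_distrib]
    refine Finset.sum_congr rfl fun p _ => ?_
    rw [obliqueField_apply, Pi.neg_apply, mul_neg]
  rw [this]
  have h2 : ∑ p : ObliqueIndex N, x p * obliqueCoord N (galerkinRHS (freqBall (d := Fin 3) N) ν (kolmogorovCoeff F N) (obliqueCoeff N x)) p =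
      2⁻¹ * (-(ν * (eGradNormSq (realTrigPoly (freqBall (d := Fin 3) N) (coeffExt (freqBall (d := Fin 3) N) (obliqueCoeff N x)))).toReal) +
        ∫ y, ⟪realTrigPoly (freqBall (d := Fin 3) N) (coeffExt (freqBall (d := Fin 3) N) (kolmogorovCoeff F N)) y, realTrigPoly (freqBall (d := Fin 3) N) (coeffExt (freqBall (d := Fin 3) N) (obliqueCoeff N x)) y⟫_ℝ) := by
    rw [← hmaster, ← hsame, hpair]
    ring
  rw [h2]
  ring

/-- `‖(Φ x)‾ k‖² = x (k,0)² + x (k,1)²` on representatives. [folklore] -/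
theorem norm_sq_obliqueCoeff_rep {N : ℕ} (x : ObliqueIndex N → ℝ) (k : ↥(obliqueReps N)) :
    ‖obliqueCoeff N x ⟨(k : Fin 3 → ℤ), mem_freqBall_of_mem_obliqueReps k.2⟩‖ ^ 2 = ∑ σ : Fin 2, x (k, σ) ^ 2 := by
  have hkm := obliqueReps_subset N k.2
  rw [obliqueCoeff_apply_of_mem x (k := ⟨(k : Fin 3 → ℤ), mem_freqBall_of_mem_obliqueReps k.2⟩) k.2, norm_smul,
    Complex.norm_I, one_mul, EuclideanSpace.norm_complexify, ← real_inner_self_eq_norm_sq]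
  simp only [sum_inner, inner_sum, real_inner_smul_left, real_inner_smul_right, inner_basisVec hkm]
  simp [Fin.sum_univ_two, sq]

/-- **`ℓ²` norm identity**: `∑_{k∈S} ‖(Φ x)‾ k‖² = 2 ∑_p x_p²`. [folklore] -/
theorem sum_norm_sq_obliqueCoeff {N : ℕ} (x : ObliqueIndex N → ℝ) :
    ∑ k ∈ freqBall (d := Fin 3) N, ‖coeffExt (freqBall (d := Fin 3) N) (obliqueCoeff N x) k‖ ^ 2 =
      2 * ∑ p : ObliqueIndex N, x p ^ 2 := by
  have hcs : IsConjSymm (coeffExt (freqBall (d := Fin 3) N) (obliqueCoeff N x)) := (isRealCoeff_obliqueCoeff x).isConjSymm_coeffExt (freqBall_symm N)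
  have h1 : ∑ k ∈ (freqBall (d := Fin 3) N), ‖coeffExt (freqBall (d := Fin 3) N) (obliqueCoeff N x) k‖ ^ 2 = ∑ k ∈ obliqueModes N, ‖coeffExt (freqBall (d := Fin 3) N) (obliqueCoeff N x) k‖ ^ 2 := by
    refine (Finset.sum_subset (obliqueModes_subset N) fun k hkS hk => ?_).symm
    rw [coeffExt_of_mem _ hkS, obliqueCoeff_apply_of_not_mem x (k := ⟨k, hkS⟩) hk]
    simp
  rw [h1, sum_obliqueModes_eq, Finset.sum_congr rfl fun k _ => by rw [hcs k, EuclideanSpace.norm_conjVec, ← two_mul],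
    ← Finset.mul_sum, Fintype.sum_prod_type, ← Finset.sum_coe_sort (obliqueReps N)]
  congr 1
  refine Finset.sum_congr rfl fun k _ => ?_
  rw [coeffExt_of_mem _ (mem_freqBall_of_mem_obliqueReps k.2)]
  exact norm_sq_obliqueCoeff_rep x k

/-! ### Coercivity of `obliqueField` on large spheres -/

/-- On the lattice `|k|² ≥ 2`. [folklore] -/
theorem two_le_freqNormSq_of_mem {N : ℕ} {k : Fin 3 → ℤ} (hk : k ∈ obliqueModes N) : 2 ≤ freqNormSq k := by
  obtain ⟨_, h0, h02, he⟩ := mem_obliqueModes.1 hk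
  rw [freqNormSq_eq_of_mem hk]
  by_cases ha : k 0 = 0
  · have h1 : k 1 ≠ 0 := fun h1 => h0 (by funext i; fin_cases i <;> simp [ha, h1, ← h02])
    obtain ⟨r, hr⟩ := he
    have hr0 : r ≠ 0 := by rintro rfl; simp at hr; exact h1 hr
    have : (1 : ℝ) ≤ (r : ℝ) ^ 2 := by
      have h1r : 1 ≤ |r| := Int.one_le_abs hr0
      have : (1 : ℝ) ≤ |(r : ℝ)| := by exact_mod_cast h1r
      nlinarith [abs_nonneg (r : ℝ), sq_abs (r : ℝ)]
    have hk1 : (k 1 : ℝ) = r + r := by exact_mod_cast hr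
    rw [hk1]; nlinarith
  · have : (1 : ℝ) ≤ (k 0 : ℝ) ^ 2 := by
      have h1r : 1 ≤ |k 0| := Int.one_le_abs ha
      have : (1 : ℝ) ≤ |(k 0 : ℝ)| := by exact_mod_cast h1r
      nlinarith [abs_nonneg (k 0 : ℝ), sq_abs (k 0 : ℝ)]
    nlinarith [sq_nonneg (k 1 : ℝ)]

/-- **Gradient lower bound**: `‖∇u‖² ≥ 16π² ∑_p x_p²` for `u = realTrigPoly S (Φ x)‾`. [folklore] -/
theorem toReal_eGradNormSq_obliqueCoeff_ge {N : ℕ} (x : ObliqueIndex N → ℝ) :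
    16 * Real.pi ^ 2 * ∑ p : ObliqueIndex N, x p ^ 2 ≤
      (eGradNormSq (realTrigPoly (freqBall (d := Fin 3) N) (coeffExt (freqBall (d := Fin 3) N) (obliqueCoeff N x)))).toReal := by
  have hcs : IsConjSymm (coeffExt (freqBall (d := Fin 3) N) (obliqueCoeff N x)) :=
    (isRealCoeff_obliqueCoeff x).isConjSymm_coeffExt (freqBall_symm N)
  rw [toReal_eGradNormSq_realTrigPoly (freqBall_symm N) hcs]
  have hterm : ∀ k ∈ freqBall (d := Fin 3) N,
      2 * ‖coeffExt (freqBall (d := Fin 3) N) (obliqueCoeff N x) k‖ ^ 2 ≤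
        freqNormSq k * ‖coeffExt (freqBall (d := Fin 3) N) (obliqueCoeff N x) k‖ ^ 2 := by
    intro k hk
    by_cases hkm : k ∈ obliqueModes N
    · exact mul_le_mul_of_nonneg_right (two_le_freqNormSq_of_mem hkm) (sq_nonneg _)
    · rw [coeffExt_of_mem _ hk, obliqueCoeff_apply_of_not_mem x (k := ⟨k, hk⟩) hkm]; simp
  have hsum := Finset.sum_le_sum hterm
  rw [← Finset.mul_sum, sum_norm_sq_obliqueCoeff] at hsum
  nlinarith [hsum, Real.pi_pos, sq_nonneg Real.pi,
    Finset.sum_nonneg (fun p (_ : p ∈ (Finset.univ : Finset (ObliqueIndex N))) => sq_nonneg (x p))]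

/-- **Work bound**: `∫ ⟪f, u⟫ ≤ |F| (∑_p x_p²)^{1/2}` (only the modes `±e` of the force contribute).
[folklore] -/
theorem integral_inner_kolmogorov_le {N : ℕ} (hN : 2 ≤ N) (F : ℝ) (x : ObliqueIndex N → ℝ) :
    ∫ y, ⟪realTrigPoly (freqBall (d := Fin 3) N) (coeffExt (freqBall (d := Fin 3) N) (kolmogorovCoeff F N)) y,
        realTrigPoly (freqBall (d := Fin 3) N) (coeffExt (freqBall (d := Fin 3) N) (obliqueCoeff N x)) y⟫_ℝ ≤
      |F| * Real.sqrt (∑ p : ObliqueIndex N, x p ^ 2) := by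
  have hS := freqBall_symm N
  have hcs : IsConjSymm (coeffExt (freqBall (d := Fin 3) N) (obliqueCoeff N x)) :=
    (isRealCoeff_obliqueCoeff x).isConjSymm_coeffExt hS
  have hgs : IsConjSymm (coeffExt (freqBall (d := Fin 3) N) (kolmogorovCoeff F N)) :=
    (isRealCoeff_kolmogorovCoeff F N).isConjSymm_coeffExt hS
  rw [integral_inner_realTrigPoly_realTrigPoly hS hgs hcs]
  have he := modeE_mem_freqBall hN
  have hne := neg_modeE_mem_freqBall hN
  -- only `±e` contribute
  have hsub : ({modeE, -modeE} : Finset (Fin 3 → ℤ)) ⊆ freqBall (d := Fin 3) N := by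
    intro k hk
    rcases Finset.mem_insert.1 hk with rfl | hk
    · exact he
    · rw [Finset.mem_singleton] at hk; rw [hk]; exact hne
  rw [← Finset.sum_subset hsub fun k hk hk2 => by
    have h1 : k ≠ modeE := fun h => hk2 (by simp [h])
    have h2 : k ≠ -modeE := fun h => hk2 (by simp [h])
    rw [coeffExt_of_mem _ hk, kolmogorovCoeff_eq_zero F h1 h2, inner_zero_left, Complex.zero_re]]
  rw [Finset.sum_pair modeE_ne_neg]
  -- the two terms
  have hnorm_g : ∀ (k : ↥(freqBall (d := Fin 3) N)), ‖kolmogorovCoeff F N k‖ ≤ |F| / 2 := fun k => by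
    simp only [kolmogorovCoeff]
    split_ifs
    · simp [norm_smul]
    · simp [norm_smul]
    · rw [norm_zero]; positivity
  set X := ∑ p : ObliqueIndex N, x p ^ 2 with hX
  have hX0 : 0 ≤ X := Finset.sum_nonneg fun p _ => sq_nonneg _
  have hce : ‖coeffExt (freqBall (d := Fin 3) N) (obliqueCoeff N x) modeE‖ ≤ Real.sqrt X := by
    rw [coeffExt_of_mem _ he]
    have hrep := modeE_mem_obliqueReps hN
    have h := norm_sq_obliqueCoeff_rep x ⟨modeE, hrep⟩
    have hle : ∑ σ : Fin 2, x (⟨modeE, hrep⟩, σ) ^ 2 ≤ X := by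
      rw [hX, Fintype.sum_prod_type]
      exact Finset.single_le_sum (f := fun k : ↥(obliqueReps N) => ∑ σ : Fin 2, x (k, σ) ^ 2)
        (fun k _ => Finset.sum_nonneg fun σ _ => sq_nonneg _) (Finset.mem_univ _)
    refine Real.le_sqrt_of_sq_le ?_
    calc ‖obliqueCoeff N x ⟨modeE, he⟩‖ ^ 2 = ∑ σ : Fin 2, x (⟨modeE, hrep⟩, σ) ^ 2 := h
      _ ≤ X := hle
  have hce' : ‖coeffExt (freqBall (d := Fin 3) N) (obliqueCoeff N x) (-modeE)‖ ≤ Real.sqrt X := by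
    rw [hcs modeE, EuclideanSpace.norm_conjVec]; exact hce
  have t1 : (⟪coeffExt (freqBall (d := Fin 3) N) (kolmogorovCoeff F N) modeE,
      coeffExt (freqBall (d := Fin 3) N) (obliqueCoeff N x) modeE⟫_ℂ).re ≤ |F| / 2 * Real.sqrt X := by
    refine (Complex.re_le_norm _).trans ((norm_inner_le_norm _ _).trans ?_)
    rw [coeffExt_of_mem (kolmogorovCoeff F N) he]
    exact mul_le_mul (hnorm_g _) hce (norm_nonneg _) (by positivity)
  have t2 : (⟪coeffExt (freqBall (d := Fin 3) N) (kolmogorovCoeff F N) (-modeE),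
      coeffExt (freqBall (d := Fin 3) N) (obliqueCoeff N x) (-modeE)⟫_ℂ).re ≤ |F| / 2 * Real.sqrt X := by
    refine (Complex.re_le_norm _).trans ((norm_inner_le_norm _ _).trans ?_)
    rw [coeffExt_of_mem (kolmogorovCoeff F N) hne]
    exact mul_le_mul (hnorm_g _) hce' (norm_nonneg _) (by positivity)
  linarith

/-- **Coercivity of `obliqueField`**: `∑_p x_p G(x)_p > 0` as soon as
`(∑_p x_p²)^{1/2} > |F|/(16 ν π²)` (`ν > 0`, `N ≥ 2`): `ν‖∇u‖² ≥ 16νπ²‖x‖²` dominates the work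
`≤ |F| ‖x‖`. [folklore] -/
theorem sum_mul_obliqueField_pos {N : ℕ} (hN : 2 ≤ N) {ν : ℝ} (hν : 0 < ν) (F : ℝ) {x : ObliqueIndex N → ℝ}
    (hx : (|F| / (16 * ν * Real.pi ^ 2)) ^ 2 < ∑ p : ObliqueIndex N, x p ^ 2) :
    0 < ∑ p : ObliqueIndex N, x p * obliqueField ν F N x p := by
  rw [sum_mul_obliqueField]
  have hG := toReal_eGradNormSq_obliqueCoeff_ge x
  have hW := integral_inner_kolmogorov_le hN F x
  set X := ∑ p : ObliqueIndex N, x p ^ 2 with hX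
  have hX0 : 0 ≤ X := Finset.sum_nonneg fun p _ => sq_nonneg _
  have hπ := Real.pi_pos
  have hsq : Real.sqrt X ^ 2 = X := Real.sq_sqrt hX0
  have hroot : |F| / (16 * ν * Real.pi ^ 2) < Real.sqrt X := by
    rw [← Real.sqrt_sq (by positivity : 0 ≤ |F| / (16 * ν * Real.pi ^ 2))]
    exact Real.sqrt_lt_sqrt (sq_nonneg _) hx
  have h16 : |F| < Real.sqrt X * (16 * ν * Real.pi ^ 2) := (div_lt_iff₀ (by positivity)).1 hroot
  have hXpos : 0 < Real.sqrt X := lt_of_le_of_lt (by positivity) hroot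
  have key : 0 < Real.sqrt X * (16 * ν * Real.pi ^ 2 * Real.sqrt X - |F|) := mul_pos hXpos (by linarith)
  have hmul : Real.sqrt X * Real.sqrt X = X := Real.mul_self_sqrt hX0
  have h2 : Real.sqrt X * (16 * ν * Real.pi ^ 2 * Real.sqrt X - |F|) =
      ν * (16 * Real.pi ^ 2 * X) - |F| * Real.sqrt X := by
    linear_combination (16 * ν * Real.pi ^ 2) * hmul
  have h1 := mul_le_mul_of_nonneg_left hG hν.le
  have hpos : 0 < ν * (eGradNormSq (realTrigPoly (freqBall (d := Fin 3) N)
      (coeffExt (freqBall (d := Fin 3) N) (obliqueCoeff N x)))).toReal -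
      ∫ y, ⟪realTrigPoly (freqBall (d := Fin 3) N) (coeffExt (freqBall (d := Fin 3) N) (kolmogorovCoeff F N)) y,
        realTrigPoly (freqBall (d := Fin 3) N) (coeffExt (freqBall (d := Fin 3) N) (obliqueCoeff N x)) y⟫_ℝ := by
    linarith
  exact mul_pos (by norm_num) hpos

/-! ### From a zero of `obliqueField` to a steady Galerkin state (the item's clauses) -/

/-- **The force as a trigonometric polynomial**: for `N ≥ 2`,
`realTrigPoly (freqBall N) f̂‾ = F sin(4π x₁) e₀` — the Kolmogorov force of the route, written as
`(F · Im e^{2πi e·x}) • e₀`. [folklore] -/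
theorem realTrigPoly_kolmogorovCoeff {N : ℕ} (hN : 2 ≤ N) (F : ℝ) :
    realTrigPoly (freqBall (d := Fin 3) N) (coeffExt (freqBall (d := Fin 3) N) (kolmogorovCoeff F N)) =
      fun y => (F * (UnitAddTorus.mFourier modeE y).im) • EuclideanSpace.single (0 : Fin 3) (1 : ℝ) := by
  have he := modeE_mem_freqBall hN
  have hne := neg_modeE_mem_freqBall hN
  funext y
  rw [realTrigPoly_apply, trigPoly_apply]
  have hsub : ({modeE, -modeE} : Finset (Fin 3 → ℤ)) ⊆ freqBall (d := Fin 3) N := by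
    intro k hk
    rcases Finset.mem_insert.1 hk with rfl | hk
    · exact he
    · rw [Finset.mem_singleton] at hk; rw [hk]; exact hne
  rw [← Finset.sum_subset hsub fun k hk hk2 => by
    have h1 : k ≠ modeE := fun h => hk2 (by simp [h])
    have h2 : k ≠ -modeE := fun h => hk2 (by simp [h])
    rw [coeffExt_of_mem _ hk, kolmogorovCoeff_eq_zero F h1 h2, smul_zero]]
  rw [Finset.sum_pair modeE_ne_neg, coeffExt_of_mem _ he, coeffExt_of_mem _ hne]
  simp only [kolmogorovCoeff, if_true, modeE_ne_neg.symm, if_false]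
  rw [UnitAddTorus.mFourier_neg]
  set z : ℂ := UnitAddTorus.mFourier modeE y with hz
  ext j
  simp only [EuclideanSpace.realPart_apply, PiLp.add_apply, PiLp.smul_apply, smul_eq_mul,
    EuclideanSpace.complexify_apply, PiLp.neg_apply]
  fin_cases j
  · simp [Complex.mul_re, Complex.mul_im, Complex.conj_re, Complex.conj_im]
    ring
  · simp
  · simp

/-- The real trigonometric polynomial of `Φ x` only charges the lattice modes (so it is mean
zero). [folklore] -/
theorem realTrigPoly_obliqueCoeff_eq {N : ℕ} (x : ObliqueIndex N → ℝ) :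
    realTrigPoly (freqBall (d := Fin 3) N) (coeffExt (freqBall (d := Fin 3) N) (obliqueCoeff N x)) =
      realTrigPoly (obliqueModes N) (coeffExt (freqBall (d := Fin 3) N) (obliqueCoeff N x)) := by
  rw [realTrigPoly_eq_comp, realTrigPoly_eq_comp, trigPoly_subset (obliqueModes_subset N) fun k hk hkm => by
    rw [coeffExt_of_mem _ hk, obliqueCoeff_apply_of_not_mem x (k := ⟨k, hk⟩) hkm]]

/-- **The steady Galerkin state attached to a zero of `obliqueField`.** Let `N ≥ 2`, `ν > 0`
and `obliqueField ν F N x = 0`; put `u = realTrigPoly (freqBall N) (Φ x)‾` and let `f` be the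
Kolmogorov force `F sin(4πx₁) e₀`. Then `u` is a Galerkin mode of order `N`, mean zero, satisfies
the tested steady Galerkin equations `∫ (⟪u,(u·∇)a⟫ + ν⟪u,Δa⟫ + ⟪f,a⟫) = 0` against every
Galerkin mode `a` of order `N`, and the steady energy equation `ν‖∇u‖² = ∫⟪f,u⟫`
(master identities I and II of the Galerkin field at a zero). [folklore] -/
theorem steady_of_obliqueField_eq_zero {N : ℕ} (hN : 2 ≤ N) {ν : ℝ} (F : ℝ) {x : ObliqueIndex N → ℝ}
    (hx : obliqueField ν F N x = 0) :
    IsGalerkinMode N (realTrigPoly (freqBall (d := Fin 3) N) (coeffExt (freqBall (d := Fin 3) N) (obliqueCoeff N x))) ∧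
    HasZeroMean (realTrigPoly (freqBall (d := Fin 3) N) (coeffExt (freqBall (d := Fin 3) N) (obliqueCoeff N x))) ∧
    (∀ a : UnitAddTorus (Fin 3) → EuclideanSpace ℝ (Fin 3), IsGalerkinMode N a →
      ∫ y, (⟪realTrigPoly (freqBall (d := Fin 3) N) (coeffExt (freqBall (d := Fin 3) N) (obliqueCoeff N x)) y,
          convect (realTrigPoly (freqBall (d := Fin 3) N) (coeffExt (freqBall (d := Fin 3) N) (obliqueCoeff N x))) a y⟫_ℝ +
        ν * ⟪realTrigPoly (freqBall (d := Fin 3) N) (coeffExt (freqBall (d := Fin 3) N) (obliqueCoeff N x)) y, laplacian a y⟫_ℝ +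
        ⟪((fun y : UnitAddTorus (Fin 3) => (F * (UnitAddTorus.mFourier modeE y).im) •
            EuclideanSpace.single (0 : Fin 3) (1 : ℝ) : UnitAddTorus (Fin 3) → EuclideanSpace ℝ (Fin 3))) y, a y⟫_ℝ) = 0) ∧
    ν * (eGradNormSq (realTrigPoly (freqBall (d := Fin 3) N) (coeffExt (freqBall (d := Fin 3) N) (obliqueCoeff N x)))).toReal =
      ∫ y, ⟪((fun y : UnitAddTorus (Fin 3) => (F * (UnitAddTorus.mFourier modeE y).im) •
            EuclideanSpace.single (0 : Fin 3) (1 : ℝ) : UnitAddTorus (Fin 3) → EuclideanSpace ℝ (Fin 3))) y,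
        realTrigPoly (freqBall (d := Fin 3) N) (coeffExt (freqBall (d := Fin 3) N) (obliqueCoeff N x)) y⟫_ℝ := by
  have hS := freqBall_symm N
  have hcs : IsConjSymm (coeffExt (freqBall (d := Fin 3) N) (obliqueCoeff N x)) :=
    (isRealCoeff_obliqueCoeff x).isConjSymm_coeffExt hS
  have hgs : IsConjSymm (coeffExt (freqBall (d := Fin 3) N) (kolmogorovCoeff F N)) :=
    (isRealCoeff_kolmogorovCoeff F N).isConjSymm_coeffExt hS
  have hcT : IsTransversal (freqBall (d := Fin 3) N) (coeffExt (freqBall (d := Fin 3) N) (obliqueCoeff N x)) :=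
    (isSolenoidalCoeff_obliqueCoeff x).isTransversal_coeffExt
  have hzero := galerkinRHS_eq_zero_of_obliqueField_eq_zero hN hx
  have hfield : ∀ k ∈ freqBall (d := Fin 3) N,
      galerkinField ν (freqBall (d := Fin 3) N) (coeffExt (freqBall (d := Fin 3) N) (kolmogorovCoeff F N))
        (coeffExt (freqBall (d := Fin 3) N) (obliqueCoeff N x)) k = 0 := fun k hk => by
    have := congrFun hzero ⟨k, hk⟩
    rwa [galerkinRHS_apply] at this
  have hforce := realTrigPoly_kolmogorovCoeff hN F
  refine ⟨⟨isSmooth_realTrigPoly _ _, isDivFree_realTrigPoly hcT, fun k hk =>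
    mFourierCoeff_realTrigPoly_eq_zero hS hcs (not_mem_freqBall.2 hk)⟩, ?_, ?_, ?_⟩
  · rw [realTrigPoly_obliqueCoeff_eq]
    exact hasZeroMean_realTrigPoly_of_zero_not_mem (zero_not_mem_obliqueModes N) _
  · intro a ha
    have hid := sum_re_inner_galerkinField_test ν hS hgs hcs hcT ha.isSmooth ha.isDivFree
      fun k hk => ha.2.2 k (not_mem_freqBall.1 hk)
    rw [Finset.sum_eq_zero fun k hk => by rw [hfield k hk, inner_zero_left, Complex.zero_re], hforce] at hid
    exact hid.symm
  · have hmaster := sum_re_inner_galerkinField_self ν hS hgs hcs hcT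
    rw [Finset.sum_eq_zero fun k hk => by rw [hfield k hk, inner_zero_right, Complex.zero_re], hforce] at hmaster
    linarith

end Summit.AnomalousDissipation.AnomalousDissipation.Theorems.Oblique

end
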